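import Literature.MathematicalPhysics.QuantumFieldTheory.Balaban1983to89.B8SectAStatements
import Literature.MathematicalPhysics.QuantumFieldTheory.Balaban1983to89.B8Lemma1NonAbelian
import Literature.MathematicalPhysics.QuantumLattice.BalabanRG

/-!
# `Balaban1983to89.B8Eq123CrossingBondsZd` — T. Bałaban, *Spaces of regular gauge field configurations on a lattice and gauge
# fixing conditions*, Commun. Math. Phys. **99** (1985) 75–102 [Balaban1985RegularSpaces], **(1.23) p. 79**: the bond set `Bʲ(c)`
# joining two neighbouring blocks, IDENTIFIED on the `ℤᵈ` carrier of the Lemma-1 certificates with their crossing-bond parametrisation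

statement-level skeleton of published theorems with citation tags; proofs where landed; nothing here is a claim about the Yang–Mills mass gap

CITATION HEADER (lean-in-tree rule).  Cell `lit-balaban`, unit `lit-balaban-r05` gen 69 (B8 fold owner), HOME `run/shared/lean/pub/lit-balaban/`.
SKELETON row served: **B8.Eq1.23** ((1.23) p. 79 [PDF 5], kind DEF) — the owed member of the owner's READING-RULE audit
`lit-balaban-r05/READING-RULE-AUDIT-B8-g69.md` §3.4: rule (a) «typed WITH ITS BODY verbatim … or at higher generality PROVIDED print's
own instance is IDENTIFIED by a kernel theorem with the tree's concrete objects at the place where print consumes the display» — the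
verbatim set `B8SectAStatements.bondsBetween` (r05 g1 v1.1, p239870; over a supplied block map) is here IDENTIFIED, on the `ℤᵈ` carrier of
`B7Prop1Explicit` (blocks of side `L`, corner `L•y′` of the block labelled `y′`, unit bonds `⟨x, x + e_ν⟩`), with the parametrisation of
the crossing bonds used where print consumes (1.23): Lemma 1 p. 79 — `B8Lemma1NonAbelian.crossing_bound` takes the bond `⟨y + r, κ⟩`,
`r ∈ [0, L)ᵈ`, `(r κ : ℕ) + 1 = L`, with `y` the corner of `B(c₋)` and `y + Le_κ` the corner of `B(c₊)`.  Page read FIRST-HAND as an image: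
render `run/shared/lean/pub/pub-balaban/b2b-balaban-ref1/pages/1985-cmp99-regular-spaces-gauge-fixing/1985-cmp99-regular-spaces-gauge-fixing-p005-x2.png`.

WHAT IS PRINTED (verbatim, p. 79).  *"Let us introduce a set of bonds. For a bond c ⊂ T^{(j)} we take a set of bonds connecting the
blocks Bʲ(c₋), Bʲ(c₊) and denote it by Bʲ(c), thus Bʲ(c) = {b ⊂ T : b₋ ∈ Bʲ(c₋), b₊ ∈ Bʲ(c₊)}. (1.23)"*; and where it is consumed
(Lemma 1, p. 79): *"For a plaquette p connecting two neighboring blocks B(c₋), B(c₊) we take two bonds b′, b″ ⊂ ∂p, b′, b″ ∈ B(c) … for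
an arbitrary bond b ∈ B(c) and b₀ being the unique bond of c belonging to B(c)."*

DICTIONARY (print ↦ Lean).  `T` ↦ `ℤᵈ` (`B7Prop1Explicit.Site d`), one blocking level (`j = 1`; `Bʲ` is the same statement for the block
size `Lʲ`, here a parameter `L`); a positively oriented unit bond `b = ⟨x, x + e_ν⟩` ↦ the pair `(x, ν)`, `b₋ = x` (`src`), `b₊ = x + e_ν`
(`tgt`); the block `B(y′)` labelled by the coarse site `y′` = the sites `x` with `blockMap L x = y′`
(`Literature.MathematicalPhysics.QuantumLattice.blockMap`: `x_i div L = y′_i`) = the corner block `L•y′ + [0, L)ᵈ` of the Lemma-1 files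
(`B8Lemma1Lattice.InBlock L (L•y′)`, `B8Lemma1NonAbelian.inBlock_iff`); the coarse bond `c = ⟨y′, y′ + e_κ⟩`.

WHAT THIS FILE PROVES (0 sorry, 0 `Prop`-valued named facts; definitions WITH BODY + theorems).
* `crossingBonds L y′ κ := bondsBetween (blockMap L) src tgt y′ (y′ + e κ)` — print's `B(c)` for `c = ⟨y′, y′ + e_κ⟩`, the INSTANCE of
  the generic (1.23) on the `ℤᵈ` carrier;
* `blockMap_eq_iff_inBlock` — `blockMap L x = y′ ↔ x ∈ B(L•y′)` (the two block vocabularies agree);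
* **`mem_crossingBonds_iff`** — `(x, ν) ∈ B(c) ↔ ν = κ ∧ ∃ r : [0, L)ᵈ, x = L•y′ + r ∧ r_κ + 1 = L`: the bonds of (1.23) ARE the
  `L^{d−1}` bonds of direction `κ` leaving the far face of `B(c₋)` — exactly the bonds `⟨y + boxVec L r, κ⟩`, `(r κ : ℕ) + 1 = L`, of
  `B8Lemma1NonAbelian.crossing_bound` (with `y = L•y′`);
* `mem_crossingBonds_iff_inBlock` — the same in corner-block words: `ν = κ ∧ x ∈ B(L•y′) ∧ x_κ + 1 = L(y′_κ + 1)`.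

HONEST SCOPE.  (i) One blocking level with block size `L` (print's `Bʲ` with `Lʲ` is the same statement with `L ↦ Lʲ`); `ℤᵈ` instead of the
torus `T` (the Lemma-1 carrier of record; the torus form is `B8SectAStatements.bondsBetweenBlocks` on `Setup`).  (ii) Bonds are taken
positively oriented (`⟨x, x + e_ν⟩`), as in every Lemma-1 file; a negatively oriented bond never joins `B(c₋)` to `B(c₊)` for
`c = ⟨y′, y′ + e_κ⟩`.  (iii) Nothing analytic; value = the kernel identification that closes rule (a)'s proviso for row B8.Eq1.23.
-/

namespace Literature.MathematicalPhysics.QuantumFieldTheory.Balaban1983to89.B8Eq123CrossingBondsZd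

open B7Prop1Explicit (e e_apply boxVec)
open B8Lemma1Lattice (InBlock)
open B8Lemma1NonAbelian (inBlock_iff)
open B8SectAStatements (bondsBetween mem_bondsBetween)
open Literature.MathematicalPhysics.QuantumLattice (blockMap)

variable {d : ℕ}

/-- `b₋ = x` for the unit bond `b = ⟨x, x + e_ν⟩` coded as `(x, ν)`. [cite: Balaban1985RegularSpaces, (1.23) p.79] -/
def src (b : (Fin d → ℤ) × Fin d) : (Fin d → ℤ) := b.1

/-- `b₊ = x + e_ν` for the unit bond `b = ⟨x, x + e_ν⟩` coded as `(x, ν)`. [cite: Balaban1985RegularSpaces, (1.23) p.79] -/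
def tgt (b : (Fin d → ℤ) × Fin d) : (Fin d → ℤ) := b.1 + e b.2

/-- **(1.23) on `ℤᵈ`**: `B(c) = {b : b₋ ∈ B(c₋), b₊ ∈ B(c₊)}` for the coarse bond `c = ⟨y′, y′ + e_κ⟩`, blocks labelled by `blockMap L`
— the instance of the generic `B8SectAStatements.bondsBetween`. [cite: Balaban1985RegularSpaces, (1.23) p.79] -/
def crossingBonds (L : ℕ) (y' : (Fin d → ℤ)) (κ : Fin d) : Set ((Fin d → ℤ) × Fin d) :=
  bondsBetween (blockMap L) src tgt y' (y' + e κ)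

/-- unfolding of `crossingBonds`. [cite: Balaban1985RegularSpaces, (1.23) p.79] -/
theorem mem_crossingBonds (L : ℕ) (y' : (Fin d → ℤ)) (κ : Fin d) (x : (Fin d → ℤ)) (ν : Fin d) :
    (x, ν) ∈ crossingBonds L y' κ ↔ blockMap L x = y' ∧ blockMap L (x + e ν) = y' + e κ :=
  Iff.rfl

/-- Euclidean division: `a div P = w ↔ Pw ≦ a < Pw + P` (`P > 0`). [folklore] -/
private theorem ediv_eq_iff_of_pos {P : ℤ} (hP : 0 < P) {a w : ℤ} : a / P = w ↔ P * w ≤ a ∧ a < P * w + P := by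
  rw [le_antisymm_iff, ← Int.lt_add_one_iff, Int.ediv_lt_iff_lt_mul hP, Int.le_ediv_iff_mul_le hP]
  have h1 : (w + 1) * P = P * w + P := by ring
  have h2 : w * P = P * w := mul_comm _ _
  rw [h1, h2]
  exact and_comm

/-- THE TWO BLOCK VOCABULARIES AGREE: `blockMap L x = y′` (the block labelled by the coarse site `y′`) iff `x ∈ B(L•y′)` (the corner block
`{x : Ly′_μ ≦ x_μ < Ly′_μ + L}` of the Lemma-1 files). [cite: Balaban1985RegularSpaces, (1.23) p.79] -/
theorem blockMap_eq_iff_inBlock {L : ℕ} (hL : 1 ≤ L) (y' x : (Fin d → ℤ)) :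
    blockMap L x = y' ↔ InBlock L ((L : ℤ) • y') x := by
  have hL0 : (0 : ℤ) < (L : ℤ) := by exact_mod_cast hL
  rw [funext_iff]
  refine forall_congr' fun i => ?_
  show x i / (L : ℤ) = y' i ↔ _
  rw [ediv_eq_iff_of_pos hL0, Pi.smul_apply, smul_eq_mul]

/-- **(1.23) IDENTIFIED WITH THE LEMMA-1 PARAMETRISATION**: a unit bond `⟨x, x + e_ν⟩` joins `B(c₋)` to `B(c₊)`, `c = ⟨y′, y′ + e_κ⟩`, iff
it has direction `κ` and starts on the far `κ`-face of `B(c₋)`: `x = L•y′ + r`, `r ∈ [0, L)ᵈ`, `r_κ + 1 = L` — the bonds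
`⟨y + boxVec L r, κ⟩`, `(r κ : ℕ) + 1 = L`, of `B8Lemma1NonAbelian.crossing_bound` with `y = L•y′` (`L^{d−1}` of them).
[cite: Balaban1985RegularSpaces, (1.23) p.79, Lemma 1 p.79 («b′, b″ ∈ B(c)», «b₀ being the unique bond of c belonging to B(c)»)] -/
theorem mem_crossingBonds_iff {L : ℕ} (hL : 1 ≤ L) (y' : (Fin d → ℤ)) (κ : Fin d) (x : (Fin d → ℤ)) (ν : Fin d) :
    (x, ν) ∈ crossingBonds L y' κ ↔
      ν = κ ∧ ∃ r : Fin d → Fin L, x = (L : ℤ) • y' + boxVec L r ∧ (r κ : ℕ) + 1 = L := by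
  have hL0 : (0 : ℤ) < (L : ℤ) := by exact_mod_cast hL
  have he1 : ∀ μ : Fin d, e μ μ = (1 : ℤ) := fun μ => by simp [e_apply]
  have he0 : ∀ {μ i : Fin d}, i ≠ μ → e μ i = (0 : ℤ) := fun {μ i} h => by simp [e_apply, h]
  rw [mem_crossingBonds, blockMap_eq_iff_inBlock hL, blockMap_eq_iff_inBlock hL, inBlock_iff]
  constructor
  · rintro ⟨⟨r, hr⟩, h2⟩
    -- the `κ`-coordinate of `b₊ = x + e_ν` lies in `[L(y′_κ + 1), L(y′_κ + 1) + L)`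
    have hκ := h2 κ
    have hxκ : x κ = (L : ℤ) * y' κ + ((r κ : ℕ) : ℤ) := by
      have := congr_fun hr κ; simpa [Pi.add_apply, Pi.smul_apply, smul_eq_mul, boxVec] using this
    have hrκ : ((r κ : ℕ) : ℤ) < L := by exact_mod_cast (r κ).isLt
    simp only [Pi.add_apply, Pi.smul_apply, smul_eq_mul, he1, hxκ, mul_add, mul_one] at hκ
    by_cases hνκ : ν = κ
    · subst hνκ
      rw [he1] at hκ
      refine ⟨rfl, r, hr, ?_⟩
      have h : ((r ν : ℕ) : ℤ) + 1 = L := by omega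
      exact_mod_cast h
    · exfalso
      rw [he0 (fun h => hνκ h.symm)] at hκ
      omega
  · rintro ⟨rfl, r, rfl, hrκ⟩
    refine ⟨⟨r, rfl⟩, fun i => ?_⟩
    have hrk : ((r ν : ℕ) : ℤ) + 1 = L := by exact_mod_cast hrκ
    have h0 : (0 : ℤ) ≤ ((r i : ℕ) : ℤ) := by positivity
    have h1 : ((r i : ℕ) : ℤ) < L := by exact_mod_cast (r i).isLt
    by_cases hi : i = ν
    · subst hi
      simp only [Pi.add_apply, Pi.smul_apply, smul_eq_mul, mul_add, boxVec, he1, mul_one]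
      omega
    · simp only [Pi.add_apply, Pi.smul_apply, smul_eq_mul, boxVec, he0 hi, add_zero]
      omega

/-- The same identification in corner-block words: `ν = κ`, `x ∈ B(L•y′)` and `x_κ + 1 = L(y′_κ + 1)` (the bond ends on the first
`κ`-layer of `B(c₊)`). [cite: Balaban1985RegularSpaces, (1.23) p.79, Lemma 1 p.79] -/
theorem mem_crossingBonds_iff_inBlock {L : ℕ} (hL : 1 ≤ L) (y' : (Fin d → ℤ)) (κ : Fin d) (x : (Fin d → ℤ)) (ν : Fin d) :
    (x, ν) ∈ crossingBonds L y' κ ↔ ν = κ ∧ InBlock L ((L : ℤ) • y') x ∧ x κ + 1 = (L : ℤ) * (y' κ + 1) := by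
  rw [mem_crossingBonds_iff hL, inBlock_iff]
  constructor
  · rintro ⟨hν, r, hx, hr⟩
    refine ⟨hν, ⟨r, hx⟩, ?_⟩
    have hrk : ((r κ : ℕ) : ℤ) + 1 = L := by exact_mod_cast hr
    have := congr_fun hx κ
    simp only [Pi.add_apply, Pi.smul_apply, smul_eq_mul, boxVec] at this
    rw [this]; linear_combination hrk
  · rintro ⟨hν, ⟨r, hx⟩, hκ⟩
    refine ⟨hν, r, hx, ?_⟩
    have := congr_fun hx κ
    simp only [Pi.add_apply, Pi.smul_apply, smul_eq_mul, boxVec] at this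
    have h : ((r κ : ℕ) : ℤ) + 1 = L := by rw [this] at hκ; linear_combination hκ
    exact_mod_cast h

/-!
## v1.1 (APPEND-ONLY §2, unit `lit-balaban-r13` gen 99, on the file owner r05 g69's written request «r13: append (a)–(d)»,
`HOME/lit-balaban-r13/INBOX.md` 2026-08-23T15:09:17Z / 15:25:14Z; v1.0 = p367770 ACCEPTED bc6bd14034b4, its 151 lines above are
byte-identical).  Four further kernel sentences about the SAME object `crossingBonds L y′ κ` of (1.23), read first-hand this session on
the ×2 render `…regular-spaces-gauge-fixing-p005-x2.png` and the text layer (`lit read … --pages 5`):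
(a) `mem_crossingBonds_iff_offset` — `B(c)` = EXACTLY the bonds of the abelian Lemma-1 file's `B8Lemma1Lattice.crossVal`
    (`θ (site y (offset μ t (L − 1))) μ` over the transverse positions `t : B8Lemma1Lattice.Trans d L μ`, fine corner `y = L•y′`);
(b) the COUNT «`B(c)` of (1.23) = the `L^{d−1}` crossing bonds» (`B8Lemma1Lattice`, module docstring; the denominator
    `Fintype.card (Trans d L μ)` of `B8Lemma1Lattice.avg`): `crossingFinset`, `card_trans`, `card_crossingFinset`, `ncard_crossingBonds`;
(c) the two p. 79 sentences print USES about `B(c)` in the proof of Lemma 1: «b₀ being the unique bond of c belonging to B(c)»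
    (`contourBond_mem_crossingBonds_iff`, `existsUnique_contourBond`) and «two bonds b′, b″ ⊂ ∂p, b′, b″ ∈ B(c)» (`parallel_mem_crossingBonds`);
(d) `smul_add_e_eq_yplus` / `mem_crossingBonds_iff_inBlock_pair` — (1.23) in the words of `B8Lemma1Lattice`: `b₋ ∈ B(L•y′)` and
    `b₊ ∈ B(yplus L (L•y′) κ)` (`yplus` = that file's corner of `B(c₊) = B(c₋) + Le_μ`).
Definitions WITH BODY (`crossingFinset`) + theorems; 0 `Prop`-facts; imports unchanged.
statement-level skeleton of published theorems with citation tags; proofs where landed; nothing here is a claim about the Yang–Mills mass gap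
-/

section AppendV11

open B8Lemma1Lattice (site yplus offset offset_apply_mu offset_apply_ne offset_apply_sub offset_lt)

/-! ### (d) (1.23) in the words of `B8Lemma1Lattice`: the two corner blocks `B(L•y′)`, `B(yplus L (L•y′) κ)` -/

/-- The corner of `B(c₊)`: `L•(y′ + e_κ)` is `B8Lemma1Lattice.yplus L (L•y′) κ` (= `L•y′ + Le_κ`, that file's *"B(c₊) = B(c₋) + L e_μ"*).
[cite: Balaban1985RegularSpaces, (1.23) p.79] -/
theorem smul_add_e_eq_yplus (L : ℕ) (y' : (Fin d → ℤ)) (κ : Fin d) :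
    (L : ℤ) • (y' + e κ) = yplus L ((L : ℤ) • y') κ := by
  funext i
  simp only [yplus, site, Pi.smul_apply, Pi.add_apply, smul_eq_mul, e_apply, Pi.single_apply]
  split_ifs <;> push_cast <;> ring

/-- **(1.23) in the words of the Lemma-1 lattice file**: `b ∈ B(c)` iff `b₋ ∈ B(L•y′)` and `b₊ ∈ B(yplus L (L•y′) κ)`
(`B8Lemma1Lattice.InBlock`, `yplus`), for `c = ⟨y′, y′ + e_κ⟩`, `L ≥ 1`. [cite: Balaban1985RegularSpaces, (1.23) p.79] -/
theorem mem_crossingBonds_iff_inBlock_pair {L : ℕ} (hL : 1 ≤ L) (y' : (Fin d → ℤ)) (κ : Fin d) (x : (Fin d → ℤ)) (ν : Fin d) :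
    (x, ν) ∈ crossingBonds L y' κ ↔ InBlock L ((L : ℤ) • y') x ∧ InBlock L (yplus L ((L : ℤ) • y') κ) (x + e ν) := by
  rw [mem_crossingBonds, ← smul_add_e_eq_yplus, blockMap_eq_iff_inBlock hL, blockMap_eq_iff_inBlock hL]

/-! ### (a) The `offset` parametrisation of `B8Lemma1Lattice.crossVal` -/

/-- **(1.23) = the `offset` parametrisation** of `B8Lemma1Lattice.crossVal` (`θ (site y (offset μ t (L − 1))) μ` over the transverse
positions `t : Trans d L μ`, fine corner `y`): `(x, ν) ∈ B(c)`, `c = ⟨y′, y′ + e_κ⟩`, iff `ν = κ` and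
`x = site (L•y′) (offset κ t (L − 1))` for a `t : B8Lemma1Lattice.Trans d L κ`. [cite: Balaban1985RegularSpaces, (1.23) p.79] -/
theorem mem_crossingBonds_iff_offset {L : ℕ} (hL : 1 ≤ L) (y' : (Fin d → ℤ)) (κ : Fin d) (x : (Fin d → ℤ)) (ν : Fin d) :
    (x, ν) ∈ crossingBonds L y' κ ↔
      ν = κ ∧ ∃ t : B8Lemma1Lattice.Trans d L κ, x = site ((L : ℤ) • y') (offset κ t (L - 1)) := by
  rw [mem_crossingBonds_iff hL]
  refine and_congr_right fun _ => ?_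
  constructor
  · rintro ⟨r, rfl, hr⟩
    refine ⟨fun ν' => r ν'.1, ?_⟩
    funext i
    simp only [Pi.add_apply, Pi.smul_apply, smul_eq_mul, boxVec, site]
    by_cases hi : i = κ
    · subst hi
      rw [offset_apply_mu]
      omega
    · rw [offset_apply_ne κ _ _ hi]
  · rintro ⟨t, rfl⟩
    refine ⟨fun i => ⟨offset κ t (L - 1) i, offset_lt κ t (by omega) i⟩, ?_, ?_⟩
    · funext i
      simp [boxVec, site]
    · show offset κ t (L - 1) κ + 1 = L
      rw [offset_apply_mu]
      omega

/-! ### (b) The count `∣B(c)∣ = L^{d−1}` -/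

/-- `B(c)` as a `Finset`: the image of the transverse positions `B8Lemma1Lattice.Trans d L κ` (that file's reading of (1.23): «the
`L^{d−1}` crossing bonds `⟨x, x + e_μ⟩`, `x ∈ B(y)`, `x_μ = y_μ + L − 1` (`Trans`, `crossVal`)»). [cite: Balaban1985RegularSpaces, (1.23) p.79] -/
noncomputable def crossingFinset (L : ℕ) (y' : (Fin d → ℤ)) (κ : Fin d) : Finset ((Fin d → ℤ) × Fin d) :=
  (Finset.univ : Finset (B8Lemma1Lattice.Trans d L κ)).image fun t => (site ((L : ℤ) • y') (offset κ t (L - 1)), κ)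

/-- `crossingFinset` enumerates exactly `B(c)` (`L ≥ 1`). [cite: Balaban1985RegularSpaces, (1.23) p.79] -/
theorem mem_crossingFinset_iff {L : ℕ} (hL : 1 ≤ L) (y' : (Fin d → ℤ)) (κ : Fin d) (b : (Fin d → ℤ) × Fin d) :
    b ∈ crossingFinset L y' κ ↔ b ∈ crossingBonds L y' κ := by
  obtain ⟨x, ν⟩ := b
  rw [mem_crossingBonds_iff_offset hL, crossingFinset, Finset.mem_image]
  constructor
  · rintro ⟨t, -, ht⟩
    simp only [Prod.mk.injEq] at ht
    exact ⟨ht.2.symm, t, ht.1.symm⟩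
  · rintro ⟨h2, t, h1⟩
    refine ⟨t, Finset.mem_univ _, ?_⟩
    simp only [Prod.mk.injEq]
    exact ⟨h1.symm, h2.symm⟩

/-- `crossingFinset` and `crossingBonds` are the same set (`L ≥ 1`). [cite: Balaban1985RegularSpaces, (1.23) p.79] -/
theorem coe_crossingFinset {L : ℕ} (hL : 1 ≤ L) (y' : (Fin d → ℤ)) (κ : Fin d) :
    (crossingFinset L y' κ : Set ((Fin d → ℤ) × Fin d)) = crossingBonds L y' κ := by
  ext b
  rw [Finset.mem_coe, mem_crossingFinset_iff hL]

/-- There are `L^{d−1}` transverse positions of the crossing bonds (1.23) (`B8Lemma1Lattice.Trans`, cite-tagged (1.23) there; the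
denominator `Fintype.card (Trans d L μ)` of `B8Lemma1Lattice.avg`). [cite: Balaban1985RegularSpaces, (1.23) p.79] -/
theorem card_trans (L : ℕ) (κ : Fin d) : Fintype.card (B8Lemma1Lattice.Trans d L κ) = L ^ (d - 1) := by
  have h : Fintype.card {ν : Fin d // ν ≠ κ} = d - 1 := by
    rw [Fintype.card_subtype_compl, Fintype.card_fin, Fintype.card_subtype_eq]
  rw [Fintype.card_fun, Fintype.card_fin, h]

/-- **`∣B(c)∣ = L^{d−1}`** (`B8Lemma1Lattice`: *"`B(c)` of (1.23) = the `L^{d−1}` crossing bonds"*; p. 79 uses the count through the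
`(d−1)(L−1)` transverse steps joining two bonds of `B(c)`). [cite: Balaban1985RegularSpaces, (1.23) p.79] -/
theorem card_crossingFinset (L : ℕ) (y' : (Fin d → ℤ)) (κ : Fin d) : (crossingFinset L y' κ).card = L ^ (d - 1) := by
  have hinj : Function.Injective
      (fun t : B8Lemma1Lattice.Trans d L κ => (site ((L : ℤ) • y') (offset κ t (L - 1)), κ)) := by
    intro t u h
    funext ν
    have hν := congr_fun (congrArg Prod.fst h) ν.1
    simp only [site, offset_apply_sub, Pi.smul_apply, smul_eq_mul] at hν
    exact Fin.ext (by omega)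
  rw [crossingFinset, Finset.card_image_of_injective _ hinj, Finset.card_univ, card_trans]

/-- `B(c)` is finite (`L ≥ 1`). [cite: Balaban1985RegularSpaces, (1.23) p.79] -/
theorem crossingBonds_finite {L : ℕ} (hL : 1 ≤ L) (y' : (Fin d → ℤ)) (κ : Fin d) : (crossingBonds L y' κ).Finite := by
  rw [← coe_crossingFinset hL]
  exact Finset.finite_toSet _

/-- **`∣B(c)∣ = L^{d−1}`**, `Set.ncard` form (`L ≥ 1`). [cite: Balaban1985RegularSpaces, (1.23) p.79] -/
theorem ncard_crossingBonds {L : ℕ} (hL : 1 ≤ L) (y' : (Fin d → ℤ)) (κ : Fin d) :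
    (crossingBonds L y' κ).ncard = L ^ (d - 1) := by
  rw [← coe_crossingFinset hL, Set.ncard_coe_finset, card_crossingFinset]

/-! ### (c) The two p. 79 sentences print uses about `B(c)` -/

/-- p. 79, Lemma 1 proof: *"b₀ being the unique bond of c belonging to B(c)"* — the straight contour `c = [L•y′, L•y′ + Le_κ]` of the fine
lattice consists of the `L` unit bonds `⟨L•y′ + i e_κ, · + e_κ⟩`, `0 ≤ i < L`; a bond `⟨L•y′ + i e_κ, · + e_κ⟩`, `i ∈ ℕ`, lies in `B(c)` iff
`i = L − 1` (the last bond of the contour, `b₀`); `L ≥ 1`. [cite: Balaban1985RegularSpaces, Lemma 1 proof p.79, (1.23) p.79] -/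
theorem contourBond_mem_crossingBonds_iff {L : ℕ} (hL : 1 ≤ L) (y' : (Fin d → ℤ)) (κ : Fin d) (i : ℕ) :
    ((L : ℤ) • y' + (i : ℤ) • e κ, κ) ∈ crossingBonds L y' κ ↔ i + 1 = L := by
  rw [mem_crossingBonds_iff_inBlock hL]
  simp only [true_and, InBlock, Pi.add_apply, Pi.smul_apply, smul_eq_mul, e_apply, ite_true, mul_one]
  constructor
  · rintro ⟨-, hx⟩
    nlinarith [hx]
  · intro hiL
    refine ⟨fun j => ?_, by nlinarith [hiL]⟩
    split_ifs <;> constructor <;> omega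

/-- p. 79: *"b₀ being the unique bond of c belonging to B(c)"* — existence and uniqueness of the index `i < L` of the contour bond
`⟨L•y′ + i e_κ, · + e_κ⟩` lying in `B(c)` (`L ≥ 1`). [cite: Balaban1985RegularSpaces, Lemma 1 proof p.79] -/
theorem existsUnique_contourBond {L : ℕ} (hL : 1 ≤ L) (y' : (Fin d → ℤ)) (κ : Fin d) :
    ∃! i : ℕ, i < L ∧ ((L : ℤ) • y' + (i : ℤ) • e κ, κ) ∈ crossingBonds L y' κ := by
  refine ⟨L - 1, ⟨by omega, (contourBond_mem_crossingBonds_iff hL y' κ (L - 1)).mpr (by omega)⟩, ?_⟩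
  rintro i ⟨-, hmem⟩
  have := (contourBond_mem_crossingBonds_iff hL y' κ i).mp hmem
  omega

/-- p. 79, Lemma 1 proof: *"For a plaquette p connecting two neighboring blocks B(c₋), B(c₊) we take two bonds b′, b″ ⊂ ∂p, b′, b″ ∈ B(c)"*
— for the plaquette `⟨x; κ, ν⟩`, `ν ≠ κ`, whose `κ`-bond `b′ = ⟨x, x + e_κ⟩` lies in `B(c)` and whose `ν`-edge `⟨x, x + e_ν⟩` stays in
`B(c₋)`, the opposite bond `b″ = ⟨x + e_ν, x + e_ν + e_κ⟩` lies in `B(c)` as well (`L ≥ 1`).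
[cite: Balaban1985RegularSpaces, Lemma 1 proof p.79] -/
theorem parallel_mem_crossingBonds {L : ℕ} (hL : 1 ≤ L) {y' x : (Fin d → ℤ)} {κ ν : Fin d} (hν : ν ≠ κ)
    (hx : (x, κ) ∈ crossingBonds L y' κ) (hxν : blockMap L (x + e ν) = y') : (x + e ν, κ) ∈ crossingBonds L y' κ := by
  rw [mem_crossingBonds_iff_inBlock hL] at hx ⊢
  refine ⟨rfl, (blockMap_eq_iff_inBlock hL y' _).mp hxν, ?_⟩
  rw [Pi.add_apply, e_apply, if_neg (Ne.symm hν), add_zero]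
  exact hx.2.2

end AppendV11

end Literature.MathematicalPhysics.QuantumFieldTheory.Balaban1983to89.B8Eq123CrossingBondsZd
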